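import Literature.GroupTheory.CentralExtensionDicyclicTransferTorsion
import Literature.GroupTheory.SpecificGroups.SL2PrimeStableCharacterExtensionCharThree
import Mathlib.LinearAlgebra.Matrix.SpecialLinearGroup
import Mathlib.FieldTheory.Finite.Basic
import Mathlib.GroupTheory.Sylow
import Mathlib.GroupTheory.SpecificGroups.Cyclic
import Mathlib.FieldTheory.IsAlgClosed.AlgebraicClosure
import Mathlib.RingTheory.IntegralDomain
import Mathlib.Algebra.CharP.Lemmas
import HarnessLib

/-!
# EXT-CRIT in characteristic 3 is a THEOREM: `sl2ZModPrime_exists_extension_of_stable_character_charThree_holds`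
# (the `SL₂(𝔽_q)` order-`3` torus, its dicyclic normaliser of index prime to `3`, and the assembly)

Topic `GroupTheory/SpecificGroups`; namespaces `Literature.GroupTheory.SpecificGroups.SL2ZModPrimeOrderThree` (the `SL₂` data)
and `Literature.GroupTheory.SpecificGroups` (the `_holds` theorem).  THEOREMS ONLY (no definition, no named fact, no `sorry`;
axioms `propext`, `Classical.choice`, `Quot.sound`).  Discharges the sibling fact
`sl2ZModPrime_exists_extension_of_stable_character_charThree` (`SL2PrimeStableCharacterExtensionCharThree.lean`; derived
reading of «`SL₂(p)`, `p` prime, has trivial Schur multiplier», Gorenstein 1982 Prop. 4.232 (i)) WITHOUT cohomology, along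
Gorenstein's own route (Prop. 4.227/4.230: cyclic Sylow `3`-subgroups inside a torus, dicyclic normaliser):

* the element `w₃ = (0 -1; 1 -1)` of order `3` (`q ≠ 3`) and its centraliser torus `C(w₃) = {(a -c; c a-c)}`
  (`mem_centralizer_w3_iff`), CYCLIC (`isCyclic_centralizer_w3`: `(a -c; c a-c) ↦ a + cω ∈ F̄^×`, `ω² + ω + 1 = 0`, injective
  because `(2ω+1)² = -3 ≠ 0`);
* an INVERTER `j = (x y; x+y -x)`, `x² + xy + y² = -1` (solvable: pigeonhole on quadratics `FiniteField.exists_root_sum_quadratic`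
  for `q` odd, `(1, 0)` at `q = 2`), with `j² = -1` and `j g j⁻¹ = g⁻¹` on the torus (`exists_inverter_w3`) — `⟨C(w₃), j⟩` is the
  dicyclic group `Q_{2(q∓1)}` [Brown VI.9 Exercise 8] (resp. `S₃` at `q = 2`);
* the torus contains a SYLOW `3`-SUBGROUP (`not_three_dvd_index_of_centralizer_w3_le`): a Sylow `3`-subgroup `P ∋ w₃` has a
  central `z ≠ 1`, which commutes with `w₃`, is not `-1` (`3`-power order), hence is a non-scalar torus element and
  `C(z) = C(w₃) ⊇ P` (`centralizer_eq_centralizer_w3`); so every subgroup containing the torus has index prime to `3`;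
* `SL₂(𝔽_q)` is generated by its elements killed by `q` (`closure_pow_eq_one_eq_top`, proof ported from the BSD tree's
  `Theorems/ManinLocalTwoThreeSL2OddPrimeStableCharacterExtension.lean`, width seat bsd-line-manin23-p2);
* `exists_dicyclic_coprimeIndex_three`: the pair `(a, b) = (generator of C(w₃), j)` with `b a b⁻¹ = a⁻¹`, `b² = -1 = a^k`
  (`k = ord(a)/2`, resp. `k = ord(a)` odd at `q = 2` where `-1 = 1` — the one kernel-decided finite check of the file is that no
  involution of `SL₂(𝔽₂)` commutes with `w₃`), `a^{2m} = 1 ⇒ k ∣ m`, index of `⟨a, b⟩` prime to `3`;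
* the assembly with `CentralExtensionDicyclicTorsion.existsUnique_extension_of_stable_of_dicyclic_coprimeIndex` (`e = 3`,
  `u` from `exists_mul_nsmul_eq_self_of_coprime`), converting the consumer's binder shape (`φ : G → K` additive and
  `G`-invariant on `ker π`) to the subtype form and back.

WHO USES IT.  BSD cell `bsd-f2-manin`, es lens F-es-27‴ (MEMO-es §32.4): the vertex `SL₂(𝔽_q)` of the `p = 3` parabolic
relative-Ihara statement E-es-36x(3, q, 1) — «`H¹ = H² = 0` with `𝔽₃`-coefficients for every prime `q ≠ 3`, including `q = 2`»,
in the extension form of the `hF` binder of `Theorems/ManinLocalTwoThreeVertexExtensionOdd.lean`.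

## References

* [Gorenstein1982] D. Gorenstein, *Finite Simple Groups*, Prop. 4.227, 4.230, 4.232 (i), 4.233 (p. 288 of the held copy
  `book:gorenstein1982-finite-simple-groups`, read). [cite: Gorenstein1982, Prop. 4.232 (i) (p. 288)]
* [Brown1982CohomologyGroups] K. S. Brown, *Cohomology of Groups*, GTM 87, VI.9 Exercise 8 (dicyclic subgroups of `SL₂(𝔽_q)`),
  VII (6.3)–(6.4) (p. 178, read). [cite: Brown1982CohomologyGroups, VI.9 Exercise 8; VII (6.3)-(6.4)]
-/

open scoped MatrixGroups
open Polynomial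

namespace Literature.GroupTheory.SpecificGroups.SL2ZModPrimeOrderThree

variable {q : ℕ} [Fact q.Prime]

/-- Entries of a product in `SL(2, R)` (plumbing). [folklore] -/
private theorem mul_apply_two {R : Type*} [CommRing R] (g h : SL(2, R)) (i j : Fin 2) :
    (g * h) i j = g i 0 * h 0 j + g i 1 * h 1 j := by
  simp [Matrix.SpecialLinearGroup.coe_mul, Matrix.mul_apply, Fin.sum_univ_two]

/-- The determinant relation of an element of `SL(2, R)` (plumbing). [folklore] -/
private theorem det_two {R : Type*} [CommRing R] (g : SL(2, R)) : g 0 0 * g 1 1 - g 0 1 * g 1 0 = 1 := by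
  have := g.det_coe
  rw [Matrix.det_fin_two] at this
  exact this

/-- In `ZMod q`, `q` a prime `≠ 3`, `3 ≠ 0` (plumbing). [folklore] -/
private theorem three_ne_zero (hq : q ≠ 3) : (3 : ZMod q) ≠ 0 := by
  intro h
  have h' : ((3 : ℕ) : ZMod q) = 0 := by exact_mod_cast h
  rw [ZMod.natCast_eq_zero_iff] at h'
  exact hq ((Nat.prime_dvd_prime_iff_eq (Fact.out : q.Prime) Nat.prime_three).mp h')

/-! ### The element `w₃ = (0 -1; 1 -1)` of order `3` and its centraliser torus -/

/-- `w₃ ^ 2 = -1 - w₃` entrywise: `w₃² = (-1 1; -1 0)`. [folklore] -/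
private theorem w3_sq {w : SL(2, ZMod q)} (hw : (w : Matrix (Fin 2) (Fin 2) (ZMod q)) = !![0, -1; 1, -1]) :
    ((w * w : SL(2, ZMod q)) : Matrix (Fin 2) (Fin 2) (ZMod q)) = !![-1, 1; -1, 0] := by
  ext i j
  fin_cases i <;> fin_cases j <;> simp [Matrix.mul_apply, Fin.sum_univ_two, hw]

/-- Plumbing (`w3_pow_three`). [folklore] -/
private theorem w3_pow_three {w : SL(2, ZMod q)} (hw : (w : Matrix (Fin 2) (Fin 2) (ZMod q)) = !![0, -1; 1, -1]) :
    w ^ 3 = 1 := by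
  rw [pow_succ, pow_two]
  ext i j
  have h2 := w3_sq hw
  fin_cases i <;> fin_cases j <;>
    simp [Matrix.mul_apply, Fin.sum_univ_two, hw, h2]

/-- Plumbing (`w3_ne_one`). [folklore] -/
private theorem w3_ne_one {w : SL(2, ZMod q)} (hw : (w : Matrix (Fin 2) (Fin 2) (ZMod q)) = !![0, -1; 1, -1]) :
    w ≠ 1 := by
  intro h
  have := congrArg (fun m : SL(2, ZMod q) => (m : Matrix (Fin 2) (Fin 2) (ZMod q)) 1 0) h
  simp [hw] at this

/-- Plumbing (`orderOf_w3`). [folklore] -/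
private theorem orderOf_w3 {w : SL(2, ZMod q)} (hw : (w : Matrix (Fin 2) (Fin 2) (ZMod q)) = !![0, -1; 1, -1]) :
    orderOf w = 3 :=
  orderOf_eq_prime (w3_pow_three hw) (w3_ne_one hw)

/-- `w₃⁻¹ = w₃²` has entries `(-1 1; -1 0)`. [folklore] -/
private theorem w3_inv {w : SL(2, ZMod q)} (hw : (w : Matrix (Fin 2) (Fin 2) (ZMod q)) = !![0, -1; 1, -1]) :
    ((w⁻¹ : SL(2, ZMod q)) : Matrix (Fin 2) (Fin 2) (ZMod q)) = !![-1, 1; -1, 0] := by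
  have h3 : w * (w * w) = 1 := by rw [← pow_three]; exact w3_pow_three hw
  rw [inv_eq_of_mul_eq_one_right h3]; exact w3_sq hw

/-- **The centraliser of `w₃` in `SL₂(𝔽_q)`** is `{(a -c; c a-c)}` (the norm-one torus of `𝔽_q[ω]`).
[cite: Brown1982CohomologyGroups, VI.9 Exercise 8 (the tori of SL_2(F_q); shape only)] -/
theorem mem_centralizer_w3_iff {w : SL(2, ZMod q)} (hw : (w : Matrix (Fin 2) (Fin 2) (ZMod q)) = !![0, -1; 1, -1])
    (g : SL(2, ZMod q)) :
    g ∈ Subgroup.centralizer ({w} : Set (SL(2, ZMod q))) ↔ g 0 1 = -g 1 0 ∧ g 1 1 = g 0 0 - g 1 0 := by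
  rw [Subgroup.mem_centralizer_singleton_iff]
  constructor
  · intro h
    have h00 := congrArg (fun m : SL(2, ZMod q) => m 0 0) h
    have h01 := congrArg (fun m : SL(2, ZMod q) => m 0 1) h
    simp only [mul_apply_two, hw] at h00 h01
    simp at h00 h01
    exact ⟨by linear_combination h00, by linear_combination h01 + h00⟩
  · rintro ⟨h1, h2⟩
    ext i j
    fin_cases i <;> fin_cases j <;> simp [mul_apply_two, hw, h1, h2] <;> ring

/-- **The centraliser torus of `w₃` is cyclic** (`q ≠ 3`): it embeds into the multiplicative group of an algebraically
closed field via `(a -c; c a-c) ↦ a + c·ω`, `ω² + ω + 1 = 0`; injective because `(2ω + 1)² = -3 ≠ 0`.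
[cite: Gorenstein1982, Prop. 4.227 and 4.232 (i) (p. 288) (the Sylow subgroups of SL_2(p) for odd primes ≠ p are cyclic: they sit in the cyclic tori)] -/
theorem isCyclic_centralizer_w3 (hq : q ≠ 3) {w : SL(2, ZMod q)}
    (hw : (w : Matrix (Fin 2) (Fin 2) (ZMod q)) = !![0, -1; 1, -1]) :
    IsCyclic (Subgroup.centralizer ({w} : Set (SL(2, ZMod q)))) := by
  classical
  let F := AlgebraicClosure (ZMod q)
  -- a primitive cube root of unity `ω`, root of `X² + X + 1`
  obtain ⟨ω, hω⟩ : ∃ ω : F, ω ^ 2 + ω + 1 = 0 := by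
    have hdeg2 : (X ^ 2 + X + 1 : F[X]).degree = 2 := by compute_degree!
    have hdeg : (X ^ 2 + X + 1 : F[X]).degree ≠ 0 := by rw [hdeg2]; decide
    obtain ⟨ω, hω⟩ := IsAlgClosed.exists_root (X ^ 2 + X + 1 : F[X]) hdeg
    exact ⟨ω, by simpa [IsRoot] using hω⟩
  have hω2 : ω ^ 2 = -ω - 1 := by linear_combination hω
  let ι := algebraMap (ZMod q) F
  have hrel : ∀ g : Subgroup.centralizer ({w} : Set (SL(2, ZMod q))),
      (g : SL(2, ZMod q)) 0 1 = -(g : SL(2, ZMod q)) 1 0 ∧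
        (g : SL(2, ZMod q)) 1 1 = (g : SL(2, ZMod q)) 0 0 - (g : SL(2, ZMod q)) 1 0 :=
    fun g => (mem_centralizer_w3_iff hw _).1 g.2
  let f : Subgroup.centralizer ({w} : Set (SL(2, ZMod q))) →* F :=
    { toFun := fun g => ι ((g : SL(2, ZMod q)) 0 0) + ι ((g : SL(2, ZMod q)) 1 0) * ω
      map_one' := by simp [ι]
      map_mul' := fun g h => by
        obtain ⟨hg1, hg2⟩ := hrel g
        simp only [Subgroup.coe_mul, mul_apply_two, hg1, hg2, map_add, map_mul, map_neg, map_sub, ι]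
        linear_combination (-(algebraMap (ZMod q) F ((g : SL(2, ZMod q)) 1 0) *
          algebraMap (ZMod q) F ((h : SL(2, ZMod q)) 1 0))) * hω2 }
  refine isCyclic_of_injective_ringHom f ((injective_iff_map_eq_one f).2 fun g hg => ?_)
  obtain ⟨hg1, hg2⟩ := hrel g
  have hdet := det_two (g : SL(2, ZMod q))
  rw [hg1, hg2] at hdet
  set A := ι ((g : SL(2, ZMod q)) 0 0) with hA
  set C' := ι ((g : SL(2, ZMod q)) 1 0) with hC
  -- `A + C ω = 1` and the norm `A² - A C + C² = 1`
  have h1 : A + C' * ω = 1 := hg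
  have h2 : A ^ 2 - A * C' + C' ^ 2 = 1 := by
    have := congrArg ι hdet
    simp only [map_sub, map_mul, map_neg, map_one, ι] at this
    rw [hA, hC]
    linear_combination this
  -- the conjugate `A + C ω̄ = 1`, `ω̄ = -1 - ω`
  have h3 : A - C' - C' * ω = 1 := by
    linear_combination (-(A - C' - C' * ω)) * h1 + h2 - C' ^ 2 * hω2
  have h3F : (3 : F) ≠ 0 := by
    haveI : CharP F q := inferInstance
    intro h
    have : ((3 : ℕ) : F) = 0 := by exact_mod_cast h
    rw [CharP.cast_eq_zero_iff F q] at this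
    exact hq ((Nat.prime_dvd_prime_iff_eq (Fact.out : q.Prime) Nat.prime_three).mp this)
  have hdisc : (2 * ω + 1) ^ 2 = -3 := by linear_combination 4 * hω2
  have h21 : (2 * ω + 1) ≠ 0 := by
    intro h0
    rw [h0] at hdisc
    have : (3 : F) = 0 := by linear_combination hdisc
    exact h3F this
  have hc : C' = 0 := by
    have : C' * (2 * ω + 1) = 0 := by linear_combination h1 - h3
    rcases mul_eq_zero.1 this with h | h
    · exact h
    · exact absurd h h21
  have ha : A = 1 := by rw [hc] at h1; simpa using h1
  have hc' : (g : SL(2, ZMod q)) 1 0 = 0 := by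
    apply (algebraMap (ZMod q) F).injective
    simpa [ι, hC] using hc
  have ha' : (g : SL(2, ZMod q)) 0 0 = 1 := by
    apply (algebraMap (ZMod q) F).injective
    simpa [ι, hA] using ha
  apply Subtype.ext
  ext i' j'
  fin_cases i' <;> fin_cases j' <;> simp [hg1, hg2, ha', hc']

/-! ### An element `j` inverting the torus (`j² = -1`): the dicyclic normaliser -/

/-- The norm form `x² + xy + y²` of `𝔽_q[ω]` represents `-1` over `𝔽_q` (pigeonhole on quadratic polynomials for `q`
odd, `q ≠ 3`; `(1, 0)` for `q = 2`). [folklore] -/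
private theorem exists_norm_eq_neg_one (hq3 : q ≠ 3) : ∃ x y : ZMod q, x ^ 2 + x * y + y ^ 2 = -1 := by
  rcases (Fact.out : q.Prime).eq_two_or_odd with h2 | hodd
  · subst h2
    exact ⟨1, 0, by decide +revert⟩
  · -- `s² + 1 + 3 t² = 0`, then `(x, y) = (s - t, 2t)`
    let f : (ZMod q)[X] := X ^ 2 + C 1
    let g : (ZMod q)[X] := C 3 * X ^ 2
    have hf : f.degree = 2 := by
      simp only [f]; rw [degree_X_pow_add_C (by norm_num)]; rfl
    have hg : g.degree = 2 := by
      simp only [g]; rw [degree_C_mul_X_pow 2 (three_ne_zero hq3)]; rfl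
    obtain ⟨s, t, hst⟩ := FiniteField.exists_root_sum_quadratic hf hg (by rw [ZMod.card]; exact hodd)
    simp only [f, g, eval_add, eval_pow, eval_X, eval_C, eval_mul] at hst
    exact ⟨s - t, 2 * t, by linear_combination hst⟩

/-- **An inverter of the torus.** For `q ≠ 3` there is `j ∈ SL₂(𝔽_q)` with `j² = -1` conjugating every element of the
centraliser torus `C(w₃)` to its inverse (`j = (x y; x+y -x)` with `x² + xy + y² = -1`); `⟨C(w₃), j⟩` is the dicyclic
group `Q_{2(q∓1)}` (for `q` odd) resp. `S₃` (`q = 2`).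
[cite: Brown1982CohomologyGroups, VI.9 Exercise 8 (the dicyclic subgroups of SL_2(F_q): a cyclic torus and an element inverting it)] -/
theorem exists_inverter_w3 (hq3 : q ≠ 3) {w : SL(2, ZMod q)}
    (hw : (w : Matrix (Fin 2) (Fin 2) (ZMod q)) = !![0, -1; 1, -1]) :
    ∃ j : SL(2, ZMod q), j * j = -1 ∧
      ∀ g ∈ Subgroup.centralizer ({w} : Set (SL(2, ZMod q))), j * g * j⁻¹ = g⁻¹ := by
  obtain ⟨x, y, hxy⟩ := exists_norm_eq_neg_one hq3
  let j : SL(2, ZMod q) := ⟨!![x, y; x + y, -x], by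
    rw [Matrix.det_fin_two_of]; linear_combination -hxy⟩
  have hj : (j : Matrix (Fin 2) (Fin 2) (ZMod q)) = !![x, y; x + y, -x] := rfl
  refine ⟨j, ?_, fun g hg => ?_⟩
  · ext i k
    fin_cases i <;> fin_cases k <;> simp [Matrix.mul_apply, Fin.sum_univ_two, hj] <;>
      first | linear_combination hxy | ring
  · obtain ⟨h1, h2⟩ := (mem_centralizer_w3_iff hw g).1 hg
    rw [mul_inv_eq_iff_eq_mul, Matrix.SpecialLinearGroup.SL2_inv_expl g]
    ext i k
    fin_cases i <;> fin_cases k <;>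
      simp [Matrix.mul_apply, Fin.sum_univ_two, hj, h1, h2] <;> ring

/-! ### `SL₂(𝔽_q)` is generated by its elements of order dividing `q` (transvections) -/

/-- **`SL₂(𝔽_q)` is generated by its elements killed by `q`** (every element is `u l u'` or `l⁻¹ u l' u'` with `u, u'` upper and
`l, l'` lower unipotent).  Proof ported verbatim from the BSD tree file
`Summits/…/Theorems/ManinLocalTwoThreeSL2OddPrimeStableCharacterExtension.lean` (`closure_pow_eq_one_eq_top`, width seat
bsd-line-manin23-p2 g9), which a Literature file cannot import.
[cite: Gorenstein1982, Prop. 4.232 (i) (p. 288) (shape: H^1 side — SL_2(p) is generated by elements of order p, so Hom(SL_2(p), K) = 0 for K of coprime exponent)] -/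
theorem closure_pow_eq_one_eq_top : Subgroup.closure {g : SL(2, ZMod q) | g ^ q = 1} = ⊤ := by
  -- elementary unipotents and their `q`-th powers
  let U : ZMod q → SL(2, ZMod q) := fun a => ⟨!![1, a; 0, 1], by simp [Matrix.det_fin_two_of]⟩
  let L : ZMod q → SL(2, ZMod q) := fun a => ⟨!![1, 0; a, 1], by simp [Matrix.det_fin_two_of]⟩
  have hU : ∀ a b, U a * U b = U (a + b) := fun a b => by
    ext i j
    fin_cases i <;> fin_cases j <;> simp [U, Matrix.mul_apply, Fin.sum_univ_two]
    ring
  have hL : ∀ a b, L a * L b = L (a + b) := fun a b => by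
    ext i j
    fin_cases i <;> fin_cases j <;> simp [L, Matrix.mul_apply, Fin.sum_univ_two]
  have hUpow : ∀ (a : ZMod q) (n : ℕ), U a ^ n = U (n * a) := fun a n => by
    induction n with
    | zero => simp only [pow_zero, Nat.cast_zero, zero_mul]; ext i j; fin_cases i <;> fin_cases j <;> simp [U]
    | succ n ih => rw [pow_succ, ih, hU]; congr 1; push_cast; ring
  have hLpow : ∀ (a : ZMod q) (n : ℕ), L a ^ n = L (n * a) := fun a n => by
    induction n with
    | zero => simp only [pow_zero, Nat.cast_zero, zero_mul]; ext i j; fin_cases i <;> fin_cases j <;> simp [L]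
    | succ n ih => rw [pow_succ, ih, hL]; congr 1; push_cast; ring
  have hq0 : ((q : ℕ) : ZMod q) = 0 := ZMod.natCast_self q
  have hU0 : U 0 = 1 := by ext i j; fin_cases i <;> fin_cases j <;> simp [U]
  have hL0 : L 0 = 1 := by ext i j; fin_cases i <;> fin_cases j <;> simp [L]
  have hUS : ∀ a, U a ∈ Subgroup.closure {g : SL(2, ZMod q) | g ^ q = 1} := fun a =>
    Subgroup.subset_closure (show U a ^ q = 1 by rw [hUpow, hq0, zero_mul, hU0])
  have hLS : ∀ a, L a ∈ Subgroup.closure {g : SL(2, ZMod q) | g ^ q = 1} := fun a =>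
    Subgroup.subset_closure (show L a ^ q = 1 by rw [hLpow, hq0, zero_mul, hL0])
  -- elements with non-zero lower-left entry are `u l u'`
  have key : ∀ g : SL(2, ZMod q), g 1 0 ≠ 0 → g ∈ Subgroup.closure {g : SL(2, ZMod q) | g ^ q = 1} := by
    intro g hc
    have hdet := det_two g
    have e00 : (U ((g 0 0 - 1) / g 1 0) * L (g 1 0) * U ((g 1 1 - 1) / g 1 0)) 0 0 = g 0 0 := by
      simp only [mul_apply_two]; simp [U, L]; field_simp; ring
    have e01 : (U ((g 0 0 - 1) / g 1 0) * L (g 1 0) * U ((g 1 1 - 1) / g 1 0)) 0 1 = g 0 1 := by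
      simp only [mul_apply_two]; simp [U, L]; field_simp; linear_combination hdet
    have e10 : (U ((g 0 0 - 1) / g 1 0) * L (g 1 0) * U ((g 1 1 - 1) / g 1 0)) 1 0 = g 1 0 := by
      simp only [mul_apply_two]; simp [U, L]
    have e11 : (U ((g 0 0 - 1) / g 1 0) * L (g 1 0) * U ((g 1 1 - 1) / g 1 0)) 1 1 = g 1 1 := by
      simp only [mul_apply_two]; simp [U, L]; field_simp; ring
    have hg : g = U ((g 0 0 - 1) / g 1 0) * L (g 1 0) * U ((g 1 1 - 1) / g 1 0) := by
      ext i j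
      fin_cases i <;> fin_cases j
      · exact e00.symm
      · exact e01.symm
      · exact e10.symm
      · exact e11.symm
    rw [hg]
    exact Subgroup.mul_mem _ (Subgroup.mul_mem _ (hUS _) (hLS _)) (hUS _)
  rw [eq_top_iff]
  intro g _
  by_cases hc : g 1 0 = 0
  · have hdet := det_two g
    rw [hc, mul_zero, sub_zero] at hdet
    have ha : g 0 0 ≠ 0 := fun h0 => by rw [h0, zero_mul] at hdet; exact zero_ne_one hdet
    have h1 : L 1 * g ∈ Subgroup.closure {g : SL(2, ZMod q) | g ^ q = 1} :=
      key (L 1 * g) (by simpa [mul_apply_two, L, hc] using ha)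
    have : g = (L 1)⁻¹ * (L 1 * g) := by group
    rw [this]
    exact Subgroup.mul_mem _ (Subgroup.inv_mem _ (hLS 1)) h1
  · exact key g hc


/-! ### A non-scalar torus element has the same centraliser as `w₃`; the torus contains a Sylow `3`-subgroup -/

/-- `-1 ≠ 1` in `SL₂(𝔽_q)` for `q ≠ 2` (plumbing). [folklore] -/
private theorem neg_one_ne_one (hq2 : q ≠ 2) : (-1 : SL(2, ZMod q)) ≠ 1 := by
  intro h
  have h00 := congrArg (fun m : SL(2, ZMod q) => (m : Matrix (Fin 2) (Fin 2) (ZMod q)) 0 0) h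
  simp only [Matrix.SpecialLinearGroup.coe_neg, Matrix.SpecialLinearGroup.coe_one, Matrix.neg_apply,
    Matrix.one_apply_eq] at h00
  have h2 : (2 : ZMod q) = 0 := by linear_combination -h00
  have h' : ((2 : ℕ) : ZMod q) = 0 := by exact_mod_cast h2
  rw [ZMod.natCast_eq_zero_iff] at h'
  exact hq2 ((Nat.prime_dvd_prime_iff_eq (Fact.out : q.Prime) Nat.prime_two).mp h')

/-- A torus element other than `±1` has EXACTLY the centraliser of `w₃` (it is `a·1 + c·w₃` with `c ≠ 0`).
[cite: Gorenstein1982, Prop. 4.227 (p. 288) (shape only: regular torus elements and their centralisers in SL_2(p))] -/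
theorem centralizer_eq_centralizer_w3 {w : SL(2, ZMod q)}
    (hw : (w : Matrix (Fin 2) (Fin 2) (ZMod q)) = !![0, -1; 1, -1]) {z : SL(2, ZMod q)}
    (hz : z ∈ Subgroup.centralizer ({w} : Set (SL(2, ZMod q)))) (hz1 : z ≠ 1) (hz2 : z ≠ -1) :
    Subgroup.centralizer ({z} : Set (SL(2, ZMod q))) = Subgroup.centralizer ({w} : Set (SL(2, ZMod q))) := by
  obtain ⟨hz01, hz11⟩ := (mem_centralizer_w3_iff hw z).1 hz
  -- `c := z 1 0 ≠ 0`, otherwise `z = ±1`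
  have hc : z 1 0 ≠ 0 := by
    intro hc
    have hdet := det_two z
    rw [hz01, hz11, hc, neg_zero, sub_zero, zero_mul, sub_zero] at hdet
    -- `z 0 0 ^ 2 = 1`
    have hsq : (z 0 0 - 1) * (z 0 0 + 1) = 0 := by linear_combination hdet
    rcases mul_eq_zero.1 hsq with h | h
    · apply hz1; ext i j
      fin_cases i <;> fin_cases j <;> simp [hz01, hz11, hc, sub_eq_zero.mp h]
    · apply hz2; ext i j
      fin_cases i <;> fin_cases j <;> simp [hz01, hz11, hc, eq_neg_of_add_eq_zero_left h]
  ext g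
  rw [mem_centralizer_w3_iff hw, Subgroup.mem_centralizer_singleton_iff]
  constructor
  · intro h
    have h00 := congrArg (fun m : SL(2, ZMod q) => m 0 0) h
    have h01 := congrArg (fun m : SL(2, ZMod q) => m 0 1) h
    simp only [mul_apply_two, hz01, hz11] at h00 h01
    constructor
    · have : z 1 0 * (g 0 1 + g 1 0) = 0 := by linear_combination h00
      rcases mul_eq_zero.1 this with h' | h'
      · exact absurd h' hc
      · linear_combination h'
    · have : z 1 0 * (g 1 1 - g 0 0 - g 0 1) = 0 := by linear_combination h01
      rcases mul_eq_zero.1 this with h' | h'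
      · exact absurd h' hc
      · have e1 : z 1 0 * (g 0 1 + g 1 0) = 0 := by linear_combination h00
        rcases mul_eq_zero.1 e1 with h'' | h''
        · exact absurd h'' hc
        · linear_combination h' + h''
  · rintro ⟨h1, h2⟩
    ext i j
    fin_cases i <;> fin_cases j <;> simp [mul_apply_two, hz01, hz11, h1, h2] <;> ring

/-- **The centraliser torus of `w₃` contains a Sylow `3`-subgroup of `SL₂(𝔽_q)`** (`q ≠ 3`), hence every subgroup containing
it has index prime to `3`: a Sylow `3`-subgroup `P ∋ w₃` has a central element `z ≠ 1`; `z` commutes with `w₃`, is not `-1`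
(its order is a power of `3`), so `C(z) = C(w₃)` and `P ≤ C(z)`.
[cite: Gorenstein1982, Prop. 4.227 and 4.232 (i) (p. 288) (the Sylow ℓ-subgroups of SL_2(p), ℓ odd ≠ p, are cyclic, inside the tori)] -/
theorem not_three_dvd_index_of_centralizer_w3_le (hq3 : q ≠ 3) {w : SL(2, ZMod q)}
    (hw : (w : Matrix (Fin 2) (Fin 2) (ZMod q)) = !![0, -1; 1, -1]) {H : Subgroup (SL(2, ZMod q))}
    (hH : Subgroup.centralizer ({w} : Set (SL(2, ZMod q))) ≤ H) : ¬ 3 ∣ H.index := by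
  classical
  haveI : Fact (Nat.Prime 3) := ⟨Nat.prime_three⟩
  -- the `3`-subgroup `⟨w⟩` and a Sylow `3`-subgroup above it
  have hW : IsPGroup 3 (Subgroup.zpowers w) :=
    IsPGroup.of_card (n := 1) (by rw [Nat.card_zpowers, orderOf_w3 hw, pow_one])
  obtain ⟨P, hWP⟩ := hW.exists_le_sylow
  have hwP : w ∈ (P : Subgroup (SL(2, ZMod q))) := hWP (Subgroup.mem_zpowers w)
  haveI : Nontrivial (P : Subgroup (SL(2, ZMod q))) :=
    ⟨⟨⟨w, hwP⟩, 1, fun h => w3_ne_one hw (congrArg Subtype.val h)⟩⟩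
  -- a non-trivial central element `z` of `P`
  haveI : Nontrivial (Subgroup.center (P : Subgroup (SL(2, ZMod q)))) := (P.isPGroup').center_nontrivial
  obtain ⟨zc, hzc⟩ := exists_ne (1 : Subgroup.center (P : Subgroup (SL(2, ZMod q))))
  set z : SL(2, ZMod q) := ((zc : (P : Subgroup (SL(2, ZMod q)))) : SL(2, ZMod q)) with hzdef
  have hzP : z ∈ (P : Subgroup (SL(2, ZMod q))) := (zc : (P : Subgroup (SL(2, ZMod q)))).2
  have hz1 : z ≠ 1 := by
    intro h
    apply hzc
    apply Subtype.ext; apply Subtype.ext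
    exact h
  -- `z` commutes with every element of `P`
  have hzcomm : ∀ p ∈ (P : Subgroup (SL(2, ZMod q))), p * z = z * p := by
    intro p hp
    have := Subgroup.mem_center_iff.1 zc.2 ⟨p, hp⟩
    exact congrArg Subtype.val this
  have hzT : z ∈ Subgroup.centralizer ({w} : Set (SL(2, ZMod q))) := by
    rw [Subgroup.mem_centralizer_singleton_iff]
    exact (hzcomm w hwP).symm
  -- `z ≠ -1`: its order is a power of `3`
  have hz2 : z ≠ -1 := by
    intro h
    obtain ⟨k, hk⟩ := P.isPGroup' ⟨z, hzP⟩
    have hk' : z ^ 3 ^ k = 1 := by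
      have := congrArg Subtype.val hk
      simpa using this
    rw [h, (Odd.pow (by decide : Odd 3)).neg_one_pow] at hk'
    rcases eq_or_ne q 2 with h2 | h2
    · subst h2
      apply hz1
      rw [h]
      decide +revert
    · exact neg_one_ne_one h2 hk'
  have hCz := centralizer_eq_centralizer_w3 hw hzT hz1 hz2
  -- `P ≤ C(z) = C(w) ≤ H`
  have hPT : (P : Subgroup (SL(2, ZMod q))) ≤ Subgroup.centralizer ({w} : Set (SL(2, ZMod q))) := by
    intro p hp
    rw [← hCz, Subgroup.mem_centralizer_singleton_iff]
    exact hzcomm p hp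
  intro h3
  exact P.not_dvd_index (h3.trans (Subgroup.index_dvd_of_le (hPT.trans hH)))

/-! ### The dicyclic pair of index prime to `3`, and the assembly -/

/-- At `q = 2`: no involution of `SL₂(𝔽₂) = S₃` commutes with the `3`-cycle `w₃` (kernel check). [folklore] -/
private theorem sl2_two_centralizer_involution_trivial :
    ∀ g : SL(2, ZMod 2), g * ⟨!![0, -1; 1, -1], by decide⟩ = ⟨!![0, -1; 1, -1], by decide⟩ * g →
      g * g = 1 → g = 1 := by
  decide

/-- Plumbing (`sl2_two_neg_one_eq_one`). [folklore] -/
private theorem sl2_two_neg_one_eq_one : (-1 : SL(2, ZMod 2)) = 1 := by decide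

omit [Fact q.Prime] in
/-- `-1` is central (plumbing). [folklore] -/
private theorem neg_one_mem_centralizer (w : SL(2, ZMod q)) :
    (-1 : SL(2, ZMod q)) ∈ Subgroup.centralizer ({w} : Set (SL(2, ZMod q))) := by
  rw [Subgroup.mem_centralizer_singleton_iff]
  ext i j
  simp

/-- **A dicyclic pair of index prime to `3` in `SL₂(𝔽_q)`, `q` a prime `≠ 3`**: a generator `a` of the cyclic torus
`C(w₃)` and an element `b` inverting it with `b² = -1 = a^k` (`k = ord(a)/2` for `q` odd; `k = ord(a)` odd at `q = 2`, where
`-1 = 1`), `a^{2m} = 1 ⇒ k ∣ m`, and `[SL₂(𝔽_q) : ⟨a, b⟩]` prime to `3` (the torus contains a Sylow `3`-subgroup).  These are the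
dicyclic subgroups `Q_{2(q∓1)}` (Brown VI.9 Exercise 8) in the orientation picked by the prime `3`; at `q = 2`, `⟨a, b⟩ = S₃`.
[cite: Brown1982CohomologyGroups, VI.9 Exercise 8 (dicyclic subgroups of SL_2(F_q)); Gorenstein1982, Prop. 4.232 (i) (p. 288)] -/
theorem exists_dicyclic_coprimeIndex_three (hq3 : q ≠ 3) :
    ∃ (a b : SL(2, ZMod q)) (k : ℕ), b * a * b⁻¹ = a⁻¹ ∧ b ^ 2 = a ^ k ∧
      (∀ m : ℕ, a ^ (2 * m) = 1 → k ∣ m) ∧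
      (Subgroup.closure ({a, b} : Set (SL(2, ZMod q)))).index.Coprime 3 := by
  classical
  let w : SL(2, ZMod q) := ⟨!![0, -1; 1, -1], by simp [Matrix.det_fin_two_of]⟩
  have hw : (w : Matrix (Fin 2) (Fin 2) (ZMod q)) = !![0, -1; 1, -1] := rfl
  haveI := isCyclic_centralizer_w3 hq3 hw
  obtain ⟨c₀, hC⟩ := (Subgroup.isCyclic_iff_exists_zpowers_eq_top
    (Subgroup.centralizer ({w} : Set (SL(2, ZMod q))))).1 inferInstance
  have hc₀ : c₀ ∈ Subgroup.centralizer ({w} : Set (SL(2, ZMod q))) := by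
    rw [← hC]; exact Subgroup.mem_zpowers c₀
  obtain ⟨j, hj2, hinv⟩ := exists_inverter_w3 hq3 hw
  -- the index of `⟨c₀, j⟩ ⊇ C(w)` is prime to `3`
  have hTle : Subgroup.centralizer ({w} : Set (SL(2, ZMod q))) ≤
      Subgroup.closure ({c₀, j} : Set (SL(2, ZMod q))) := by
    rw [← hC, Subgroup.zpowers_le]
    exact Subgroup.subset_closure (by simp)
  have hcop : (Subgroup.closure ({c₀, j} : Set (SL(2, ZMod q)))).index.Coprime 3 :=
    (Nat.Prime.coprime_iff_not_dvd Nat.prime_three).2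
      (not_three_dvd_index_of_centralizer_w3_le hq3 hw hTle) |>.symm
  -- `-1 ∈ C(w) = ⟨c₀⟩`: `-1 = c₀ ^ i`
  have hneg : (-1 : SL(2, ZMod q)) ∈ Subgroup.zpowers c₀ := by
    rw [hC]; exact neg_one_mem_centralizer w
  set n : ℕ := orderOf c₀ with hn
  have hnpos : 0 < n := orderOf_pos c₀
  obtain ⟨i, -, hi⟩ : ∃ i < n, c₀ ^ i = -1 := by
    have := hneg
    rw [mem_zpowers_iff_mem_range_orderOf, Finset.mem_image] at this
    obtain ⟨i, hi, h⟩ := this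
    exact ⟨i, Finset.mem_range.1 hi, h⟩
  -- `a ^ (2m) = 1 ⇒ n ∣ 2m`
  have hdvd : ∀ m : ℕ, c₀ ^ (2 * m) = 1 → n ∣ 2 * m := fun m hm => orderOf_dvd_of_pow_eq_one hm
  by_cases hq2 : q = 2
  · -- `q = 2`: `-1 = 1`, `n` is odd (no involution commutes with `w`), take `k = n`
    subst hq2
    have hodd : ¬ 2 ∣ n := by
      intro h2
      haveI : Fact (Nat.Prime 2) := ⟨Nat.prime_two⟩
      have hcard : 2 ∣ Nat.card (Subgroup.zpowers c₀) := by rwa [Nat.card_zpowers]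
      obtain ⟨g, hg⟩ := exists_prime_orderOf_dvd_card' (G := Subgroup.zpowers c₀) 2 hcard
      have hg2 : (g : SL(2, ZMod 2)) * g = 1 := by
        have h' := pow_orderOf_eq_one g
        rw [hg, pow_two] at h'
        have := congrArg Subtype.val h'
        simpa using this
      have hgT : (g : SL(2, ZMod 2)) ∈ Subgroup.centralizer ({w} : Set (SL(2, ZMod 2))) := by
        rw [← hC]; exact g.2
      rw [Subgroup.mem_centralizer_singleton_iff] at hgT
      have hg1 : (g : SL(2, ZMod 2)) = 1 := sl2_two_centralizer_involution_trivial g hgT hg2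
      have : g = 1 := Subtype.ext hg1
      rw [this, orderOf_one] at hg
      exact absurd hg (by norm_num)
    refine ⟨c₀, j, n, hinv c₀ hc₀, ?_, fun m hm => ?_, hcop⟩
    · rw [pow_two, hj2, sl2_two_neg_one_eq_one, hn, pow_orderOf_eq_one]
    · exact (Nat.Coprime.dvd_of_dvd_mul_left
        ((Nat.Prime.coprime_iff_not_dvd Nat.prime_two).2 hodd).symm (hdvd m hm))
  · -- `q` odd: `n = 2k` and `-1 = c₀ ^ k`
    have hn2 : 2 ∣ n := by
      have h := orderOf_dvd_of_mem_zpowers hneg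
      have ho : orderOf (-1 : SL(2, ZMod q)) = 2 := by
        refine orderOf_eq_prime ?_ (neg_one_ne_one hq2)
        rw [pow_two]; ext i' j'; simp
      rwa [ho] at h
    obtain ⟨k, hk⟩ := hn2
    have hkpos : 0 < k := by
      rcases Nat.eq_zero_or_pos k with h0 | h0
      · rw [h0, mul_zero] at hk; omega
      · exact h0
    -- `c₀ ^ k = -1`: `(-1)² = 1 ⇒ n ∣ 2 i ⇒ k ∣ i`, `i = k t` with `t` odd since `-1 ≠ 1`
    have hck2 : (c₀ ^ k) ^ 2 = 1 := by
      rw [← pow_mul, mul_comm, ← hk, hn, pow_orderOf_eq_one]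
    have hck : c₀ ^ k = -1 := by
      have h2i : n ∣ 2 * i := by
        apply orderOf_dvd_of_pow_eq_one
        rw [pow_mul', hi, neg_one_sq]
      rw [hk] at h2i
      obtain ⟨t, ht⟩ := Nat.dvd_of_mul_dvd_mul_left (by norm_num : 0 < 2) h2i
      rw [ht, pow_mul] at hi
      rcases Nat.even_or_odd t with ⟨u, hu⟩ | ⟨u, hu⟩
      · exfalso
        rw [hu, ← two_mul, pow_mul, hck2, one_pow] at hi
        exact neg_one_ne_one hq2 hi.symm
      · rw [hu, pow_succ, pow_mul, hck2, one_pow, one_mul] at hi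
        exact hi
    refine ⟨c₀, j, k, hinv c₀ hc₀, by rw [pow_two, hj2, hck], fun m hm => ?_, hcop⟩
    have := hdvd m hm
    rw [hk] at this
    obtain ⟨r, hr⟩ := this
    exact ⟨r, Nat.eq_of_mul_eq_mul_left (by norm_num : 0 < 2) (by rw [hr]; ring)⟩

end Literature.GroupTheory.SpecificGroups.SL2ZModPrimeOrderThree

/-! ### The characteristic-`3` EXT-CRIT holds -/

namespace Literature.GroupTheory.SpecificGroups

open SL2ZModPrimeOrderThree Literature.GroupTheory.CentralExtensionDicyclic
  Literature.GroupTheory.CentralExtensionDicyclicTorsion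

/-- **F-es-27‴ holds: EXT-CRIT for `SL₂(𝔽_q)`, `q` a prime `≠ 3`, characteristic-`3` coefficients** — the named fact
`sl2ZModPrime_exists_extension_of_stable_character_charThree` (derived reading of «`M(SL₂(p)) = 1`», Gorenstein 1982
Prop. 4.232 (i)) is a THEOREM: transfer to the dicyclic subgroup `⟨C(w₃), j⟩` of index prime to `3`
(`exists_dicyclic_coprimeIndex_three`) + the torsion-free form of the dicyclic central-extension computation
(`CentralExtensionDicyclicTorsion.existsUnique_extension_of_stable_of_dicyclic_coprimeIndex`), generation of `SL₂(𝔽_q)` by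
elements of order `q` (`closure_pow_eq_one_eq_top`); no cohomology.
[cite: Gorenstein1982, Prop. 4.232 (i) (p. 288); Brown1982CohomologyGroups, VII (6.3)-(6.4), VI.9 Exercise 8] -/
theorem sl2ZModPrime_exists_extension_of_stable_character_charThree_holds :
    sl2ZModPrime_exists_extension_of_stable_character_charThree := by
  intro q hq hq3 G _ K _ _ π hπ φ hφadd hφinv
  haveI : Fact q.Prime := ⟨hq⟩
  obtain ⟨a, b, k, hab, hb2, hak, hidx⟩ := exists_dicyclic_coprimeIndex_three (q := q) hq3
  -- `K` is `3`-torsion and `q` acts invertibly on it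
  have hK : ∀ y : K, 3 • y = 0 := fun y => by
    have h3 : (3 : K) = 0 := by
      have := CharP.cast_eq_zero K 3
      simpa using this
    rw [nsmul_eq_mul]
    simp [h3]
  have hq3' : q.Coprime 3 := (Nat.coprime_primes hq Nat.prime_three).2 hq3
  obtain ⟨u, hu⟩ := exists_mul_nsmul_eq_self_of_coprime hq3' hK
  -- the stable character on `ker π` in subtype form
  let ψ : π.ker → K := fun x => φ x
  have hψ : ∀ x y : π.ker, ψ (x * y) = ψ x + ψ y := fun x y => hφadd x x.2 y y.2
  have hst : ∀ (g : G) (x : π.ker) (hx : g⁻¹ * (x : G) * g ∈ π.ker), ψ ⟨g⁻¹ * x * g, hx⟩ = ψ x := by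
    intro g x hx
    have := hφinv g⁻¹ x x.2
    simpa [ψ] using this
  obtain ⟨Ψ, ⟨hΨadd, hΨext⟩, -⟩ := existsUnique_extension_of_stable_of_dicyclic_coprimeIndex
    closure_pow_eq_one_eq_top (fun s hs => hs) hab hb2 hak hidx π hπ hK hu ψ hψ hst
  exact ⟨Ψ, hΨadd, fun n hn => hΨext ⟨n, hn⟩⟩

end Literature.GroupTheory.SpecificGroups
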